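import Literature.Analysis.FluidPDE.ElgindiPolarEnergyTwoWeighted
import Literature.Analysis.FluidPDE.ElgindiPolarSingularWeights
import Literature.Analysis.FluidPDE.ElgindiPolarIBPThree
import HarnessLib

/-!
# The second energy identity with radial and singular angular weights
([Elgindi2021] §7.3, Proposition 7.7, Step 2)

Topic `Literature/Analysis/FluidPDE`. Proof file (everything proved, no definitions, no named
facts) on the proof path of the named fact
`Literature.Analysis.FluidPDE.Elgindi.ElgindiGhoulMasmoudi2021_stabilityCore`
(`ElgindiStabilityDecomposition.lean`). T. M. Elgindi, Ann. of Math. 194 (2021) =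
arXiv:1904.04795, §7.3, proof of Proposition 7.7, Step 2 "Radial and (weak) angular weights"
(p. 21–22 of the held text):

> "As in Step 1, we multiply (7.1) by `−∂_θθΨ w²/sin(2θ)^η` and integrate. We get:
> `Σ_{i=1}^5 I_i = −(F, ∂_θθΨ w²/sin(2θ)^η)`, where
> `I₁ = α²(R²∂_{RR}Ψ, ∂_θθΨ w²/sin(2θ)^η)`, `I₂ = (α(5+α)R∂_RΨ, ∂_θθΨ w²/sin(2θ)^η)`,
> `I₃ = (∂_θθΨ, ∂_θθΨ w²/sin(2θ)^η)`, `I₄ = −(∂_θ(tan(θ)Ψ), ∂_θθΨ w²/sin(2θ)^η)`,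
> `I₅ = 6(Ψ, ∂_θθΨ w²/sin(2θ)^η)`. […] After integrating by parts in the right way, `I₁` and `I₄`
> contain positive terms and some terms which we control by the information we gained from Step 1.
> […] `I₁ = α²(R²∂_{Rθ}Ψ, ∂_{Rθ}Ψ w²/sin(2θ)^η) − α²(2η(η+1))(R²∂_RΨ, ∂_RΨ w²/sin^{2+η}(2θ)) + E`.
> […] `I₄ ≥ (sin²(θ)(∂_θΨ̄)², w²/sin^η(2θ)) − C|Fw|²_{L²}`."

This file proves the EXACT identity behind these displays, in the a-priori class of Step 1
(`Ψ = cos θ·χ`, `χ ∈ C³(ℝ²)` compactly supported inside `R > 0` with `χ(R,0) = 0`), for a radial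
weight `W ∈ C¹((0,∞))` (`W = w²` downstream), `M = R²W`, and the angular weight
`u = sin(2θ)^{−η}`, `0 ≤ η < 1` (`s = sin 2θ`, `c = cos 2θ`,
`q = cos²θ + 2sin²θ + ½(1−η)cos 2θ`):

  `∫∫ L(Ψ)(−∂_θθΨ) W u = α²[ −∫∫ M′u ∂_RΨ ∂_θθΨ + ∫∫ M u (∂_{Rθ}Ψ)² − 2η∫∫ M u (∂_RΨ)²`
  `− 2η(1+η)∫∫ M c² u (∂_RΨ/s)² ] + α(5+α)∫∫ W u R∂_RΨ ∂_θθΨ + ∫∫ W u (∂_θθΨ)²`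
  `+ (1−2η)∫∫ W u Ψ² − ½(1+η)∫∫ W c u χ² + ∫∫ W q u (∂_θχ)² − 2η(1+η)∫∫ W c² u (Ψ/s)²`
  `+ 6∫∫ W u Ψ ∂_θθΨ`

(`integral_strip_ellipticOp_mul_neg_dθdθ_singular`). The `I₁`-part is the polarized radial
integration by parts followed by the singular angular ones **L1**, **L2** of
`ElgindiPolarIBPThree.lean` on the Dirichlet slices `∂_RΨ(R,·)` (`∫ u′ f f′ = −½∫ u″ f²`,
`u″ = 4η(η+1)c²u/s² + 4ηu`); the `I₄`-part is **L3**, **L4**, **L6** on the slices `χ(R,·)`,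
`∂_θχ(R,·)` (the printed `I_{4,1} + I_{4,2} + I_{4,3} + E` decomposition made explicit: the
coefficient `q ≥ (3−η)/2·cos²θ + (3+η)/2·sin²θ ≥ 1` of `(∂_θχ)²` and the exact lower-order terms).
-/

noncomputable section

open MeasureTheory Set Real Filter Function intervalIntegral
open _root_.Topology

namespace Literature.Analysis.FluidPDE

namespace Elgindi

set_option maxHeartbeats 800000 in
/-- **The second energy identity with the weight `W(R)·sin(2θ)^{−η}`** (Proposition 7.7, Step 2).
See the module docstring for the displayed form. [cite: Elgindi2021, §7.3 proof of Proposition 7.7, Step 2 (pp. 21–22 of arXiv:1904.04795)] -/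
theorem integral_strip_ellipticOp_mul_neg_dθdθ_singular (α : ℝ) {η : ℝ} (hη0 : 0 ≤ η) (hη1 : η < 1)
    {W : ℝ → ℝ} (hW : ContDiffOn ℝ 1 W (Ioi 0))
    {χ : ℝ → ℝ → ℝ} (hχ : ContDiff ℝ 3 (uncurry χ)) (hs : HasCompactSupport (uncurry χ))
    (hpos : ∀ p ∈ tsupport (uncurry χ), 0 < p.1) (hχ0 : ∀ R, χ R 0 = 0) {Ψ : ℝ → ℝ → ℝ}
    (hΨ : Ψ = fun R θ => Real.cos θ * χ R θ) :
    ∫ p in strip, ellipticOp α Ψ p.1 p.2 * (-dθ (dθ Ψ) p.1 p.2) * W p.1 * Real.sin (2 * p.2) ^ (-η) =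
      α ^ 2 * (-(∫ p in strip, deriv (fun R => R ^ 2 * W R) p.1 * dz Ψ p.1 p.2 * dθ (dθ Ψ) p.1 p.2 *
            Real.sin (2 * p.2) ^ (-η)) +
          (∫ p in strip, p.1 ^ 2 * W p.1 * dz (dθ Ψ) p.1 p.2 ^ 2 * Real.sin (2 * p.2) ^ (-η)) -
          2 * η * (∫ p in strip, p.1 ^ 2 * W p.1 * dz Ψ p.1 p.2 ^ 2 * Real.sin (2 * p.2) ^ (-η)) -
          2 * η * (1 + η) * (∫ p in strip, p.1 ^ 2 * W p.1 * Real.cos (2 * p.2) ^ 2 *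
            (dz Ψ p.1 p.2 / Real.sin (2 * p.2)) ^ 2 * Real.sin (2 * p.2) ^ (-η))) +
      α * (5 + α) * (∫ p in strip, W p.1 * (p.1 * dz Ψ p.1 p.2) * dθ (dθ Ψ) p.1 p.2 * Real.sin (2 * p.2) ^ (-η)) +
      (∫ p in strip, W p.1 * dθ (dθ Ψ) p.1 p.2 ^ 2 * Real.sin (2 * p.2) ^ (-η)) +
      ((1 - 2 * η) * (∫ p in strip, W p.1 * Ψ p.1 p.2 ^ 2 * Real.sin (2 * p.2) ^ (-η)) -
        (1 / 2) * (1 + η) * (∫ p in strip, W p.1 * Real.cos (2 * p.2) * χ p.1 p.2 ^ 2 * Real.sin (2 * p.2) ^ (-η)) +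
        (∫ p in strip, W p.1 * (Real.cos p.2 ^ 2 + 2 * Real.sin p.2 ^ 2 + (1 / 2) * (1 - η) * Real.cos (2 * p.2)) *
          dθ χ p.1 p.2 ^ 2 * Real.sin (2 * p.2) ^ (-η)) -
        2 * η * (1 + η) * (∫ p in strip, W p.1 * Real.cos (2 * p.2) ^ 2 * (Ψ p.1 p.2 / Real.sin (2 * p.2)) ^ 2 *
          Real.sin (2 * p.2) ^ (-η))) +
      6 * ∫ p in strip, W p.1 * Ψ p.1 p.2 * dθ (dθ Ψ) p.1 p.2 * Real.sin (2 * p.2) ^ (-η) := by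
  -- the weights on `(0,∞)`
  set M : ℝ → ℝ := fun R => R ^ 2 * W R with hM
  have hMd : ContDiffOn ℝ 1 M (Ioi 0) := (contDiffOn_id.pow 2).mul hW
  have hWc : ContinuousOn W (Ioi 0) := hW.continuousOn
  have hMc : ContinuousOn M (Ioi 0) := hMd.continuousOn
  have hM'c : ContinuousOn (deriv M) (Ioi 0) := (hMd.deriv_of_isOpen (m := 0) isOpen_Ioi (by norm_num)).continuousOn
  -- regularity and support of the profile
  have hχ2 : ContDiff ℝ 2 (uncurry χ) := hχ.of_le (by norm_num)
  have hχ1 : ContDiff ℝ 1 (uncurry χ) := hχ.of_le (by norm_num)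
  have hΨ3 : ContDiff ℝ 3 (uncurry Ψ) := by rw [hΨ]; exact contDiff_cosProfile hχ
  have hΨ2 : ContDiff ℝ 2 (uncurry Ψ) := hΨ3.of_le (by norm_num)
  have hΨ1 : ContDiff ℝ 1 (uncurry Ψ) := hΨ3.of_le (by norm_num)
  have hΨs : HasCompactSupport (uncurry Ψ) := by rw [hΨ]; exact hasCompactSupport_cosProfile hs
  have hdzΨ : ContDiff ℝ 2 (uncurry (dz Ψ)) := contDiff_dz_of_contDiff (n := 2) hΨ3
  have hdz2Ψ : ContDiff ℝ 1 (uncurry (dz (dz Ψ))) := contDiff_dz_of_contDiff (n := 1) hdzΨ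
  have hdθΨ : ContDiff ℝ 2 (uncurry (dθ Ψ)) := contDiff_dθ_of_contDiff (n := 2) hΨ3
  have hdθ2Ψ : ContDiff ℝ 1 (uncurry (dθ (dθ Ψ))) := contDiff_dθ_of_contDiff (n := 1) hdθΨ
  have hdzdθΨ : ContDiff ℝ 1 (uncurry (dz (dθ Ψ))) := contDiff_dz_of_contDiff (n := 1) hdθΨ
  have hdθdzΨ : ContDiff ℝ 1 (uncurry (dθ (dz Ψ))) := contDiff_dθ_of_contDiff (n := 1) hdzΨ
  have hdzdθ2Ψ : ContDiff ℝ 0 (uncurry (dz (dθ (dθ Ψ)))) := contDiff_dz_of_contDiff (n := 0) hdθ2Ψ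
  have hdθχ : ContDiff ℝ 2 (uncurry (dθ χ)) := contDiff_dθ_of_contDiff (n := 2) hχ
  have hdθ2χ : ContDiff ℝ 1 (uncurry (dθ (dθ χ))) := contDiff_dθ_of_contDiff (n := 1) hdθχ
  have hdzχ : ContDiff ℝ 2 (uncurry (dz χ)) := contDiff_dz_of_contDiff (n := 2) hχ
  have hdzΨs : HasCompactSupport (uncurry (dz Ψ)) := hasCompactSupport_dz hΨs
  have hdθΨs : HasCompactSupport (uncurry (dθ Ψ)) := hasCompactSupport_dθ_of hΨs
  have hdθ2Ψs : HasCompactSupport (uncurry (dθ (dθ Ψ))) := hasCompactSupport_dθ_of hdθΨs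
  have hdzdθΨs : HasCompactSupport (uncurry (dz (dθ Ψ))) := hasCompactSupport_dz hdθΨs
  have hdθχs : HasCompactSupport (uncurry (dθ χ)) := hasCompactSupport_dθ_of hs
  have hdzχs : HasCompactSupport (uncurry (dz χ)) := hasCompactSupport_dz hs
  have cχ : Continuous fun p : ℝ × ℝ => χ p.1 p.2 := hχ.continuous
  have cΨ : Continuous fun p : ℝ × ℝ => Ψ p.1 p.2 := hΨ3.continuous
  have cdz : Continuous fun p : ℝ × ℝ => dz Ψ p.1 p.2 := hdzΨ.continuous
  have cdz2 : Continuous fun p : ℝ × ℝ => dz (dz Ψ) p.1 p.2 := hdz2Ψ.continuous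
  have cdθ : Continuous fun p : ℝ × ℝ => dθ Ψ p.1 p.2 := hdθΨ.continuous
  have cdθ2 : Continuous fun p : ℝ × ℝ => dθ (dθ Ψ) p.1 p.2 := hdθ2Ψ.continuous
  have cdzdθ : Continuous fun p : ℝ × ℝ => dz (dθ Ψ) p.1 p.2 := hdzdθΨ.continuous
  have cdzdθ2 : Continuous fun p : ℝ × ℝ => dz (dθ (dθ Ψ)) p.1 p.2 := hdzdθ2Ψ.continuous
  have cdθχ : Continuous fun p : ℝ × ℝ => dθ χ p.1 p.2 := hdθχ.continuous
  have cdθ2χ : Continuous fun p : ℝ × ℝ => dθ (dθ χ) p.1 p.2 := hdθ2χ.continuous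
  -- vanishing near the axis
  obtain ⟨a, ha, hva⟩ := exists_pos_forall_fst_lt_eq_zero hs hpos
  have hvaχ : ∀ p : ℝ × ℝ, p.1 < a → χ p.1 p.2 = 0 := fun p hp => hva p hp
  have hvaΨ : ∀ p : ℝ × ℝ, p.1 < a → Ψ p.1 p.2 = 0 := fun p hp => by rw [hΨ]; simp [hvaχ p hp]
  have vanish_dz : ∀ (G : ℝ → ℝ → ℝ), (∀ p : ℝ × ℝ, p.1 < a → G p.1 p.2 = 0) → ∀ p : ℝ × ℝ, p.1 < a → dz G p.1 p.2 = 0 := by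
    intro G hG p hp
    show deriv (fun R' => G R' p.2) p.1 = 0
    have : (fun R' => G R' p.2) =ᶠ[𝓝 p.1] fun _ => 0 :=
      Filter.eventuallyEq_of_mem (Iio_mem_nhds hp) fun R' hR' => hG (R', p.2) hR'
    rw [this.deriv_eq, deriv_const]
  have vanish_dθ : ∀ (G : ℝ → ℝ → ℝ), (∀ p : ℝ × ℝ, p.1 < a → G p.1 p.2 = 0) → ∀ p : ℝ × ℝ, p.1 < a → dθ G p.1 p.2 = 0 := by
    intro G hG p hp
    show deriv (fun θ' => G p.1 θ') p.2 = 0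
    have : (fun θ' => G p.1 θ') = fun _ => 0 := funext fun θ' => hG (p.1, θ') hp
    rw [this, deriv_const]
  have hvadz : ∀ p : ℝ × ℝ, p.1 < a → dz Ψ p.1 p.2 = 0 := vanish_dz Ψ hvaΨ
  have hvadθ : ∀ p : ℝ × ℝ, p.1 < a → dθ Ψ p.1 p.2 = 0 := vanish_dθ Ψ hvaΨ
  have hvadθ2 : ∀ p : ℝ × ℝ, p.1 < a → dθ (dθ Ψ) p.1 p.2 = 0 := vanish_dθ (dθ Ψ) hvadθ
  have hvadθχ : ∀ p : ℝ × ℝ, p.1 < a → dθ χ p.1 p.2 = 0 := vanish_dθ χ hvaχ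
  -- Dirichlet data
  have hD0 : ∀ R, Ψ R 0 = 0 := fun R => by rw [hΨ]; simp [hχ0 R]
  have hD1 : ∀ R, Ψ R (π / 2) = 0 := fun R => by rw [hΨ]; simp
  have hdzχ0 : ∀ R, dz χ R 0 = 0 := dz_eq_zero_of_forall hχ0
  have hdzΨ_eq : ∀ R θ, dz Ψ R θ = Real.cos θ * dz χ R θ := fun R θ => by rw [hΨ, dz_cosProfile hχ1]
  have hE0 : ∀ R, dz Ψ R 0 = 0 := fun R => by rw [hdzΨ_eq]; simp [hdzχ0 R]
  have hE1 : ∀ R, dz Ψ R (π / 2) = 0 := fun R => by rw [hdzΨ_eq]; simp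
  -- uniform bounds `|Ψ| ≤ K₁ s`, `|∂_RΨ| ≤ K₂ s` on the closed strip
  obtain ⟨K₁, hK₁0, hK₁⟩ := exists_forall_abs_cos_mul_le_sin_two_mul hχ1 hs hχ0
  obtain ⟨K₂, hK₂0, hK₂⟩ := exists_forall_abs_cos_mul_le_sin_two_mul (hdzχ.of_le (by norm_num)) hdzχs hdzχ0
  have hΨK : ∀ R, ∀ θ ∈ Icc 0 (π / 2), |Ψ R θ| ≤ K₁ * Real.sin (2 * θ) := fun R θ hθ => by
    rw [hΨ]; exact hK₁ R θ hθ
  have hdzK : ∀ R, ∀ θ ∈ Icc 0 (π / 2), |dz Ψ R θ| ≤ K₂ * Real.sin (2 * θ) := fun R θ hθ => by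
    rw [hdzΨ_eq]; exact hK₂ R θ hθ
  -- a radial bound of the support and a bound of `M` on it
  obtain ⟨B, hB⟩ := exists_forall_fst_gt_eq_zero hΨs
  have hBdz : ∀ p : ℝ × ℝ, B < p.1 → dz Ψ p.1 p.2 = 0 := by
    intro p hp
    show deriv (fun R' => Ψ R' p.2) p.1 = 0
    have : (fun R' => Ψ R' p.2) =ᶠ[𝓝 p.1] fun _ => 0 :=
      Filter.eventuallyEq_of_mem (Ioi_mem_nhds hp) fun R' hR' => hB (R', p.2) hR'
    rw [this.deriv_eq, deriv_const]
  obtain ⟨CM, hCM⟩ := isCompact_Icc.exists_bound_of_continuousOn (s := Icc a (max a B))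
    (hMc.mono fun R hR => lt_of_lt_of_le ha hR.1)
  obtain ⟨CW, hCW⟩ := isCompact_Icc.exists_bound_of_continuousOn (s := Icc a (max a B))
    (hWc.mono fun R hR => lt_of_lt_of_le ha hR.1)
  have hCM0 : 0 ≤ CM := (norm_nonneg _).trans (hCM a ⟨le_rfl, le_max_left _ _⟩)
  have hCW0 : 0 ≤ CW := (norm_nonneg _).trans (hCW a ⟨le_rfl, le_max_left _ _⟩)
  -- facts on the open strip
  have hsin : ∀ p ∈ strip, 0 < Real.sin (2 * p.2) := fun p hp =>
    Real.sin_pos_of_pos_of_lt_pi (by linarith [hp.2.1]) (by linarith [hp.2.2])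
  -- mixed partials commute on the strip
  have hcomm1 : ∀ p ∈ strip, dθ (dz Ψ) p.1 p.2 = dz (dθ Ψ) p.1 p.2 := fun p hp => dθ_dz_eq_dz_dθ hΨ2.contDiffOn hp
  have hcommA : ∀ p ∈ strip, dz (dθ (dθ Ψ)) p.1 p.2 = dθ (dθ (dz Ψ)) p.1 p.2 := by
    intro p hp
    rw [← dθ_dz_eq_dz_dθ hdθΨ.contDiffOn hp]
    exact dθ_congr (fun q hq => (hcomm1 q hq).symm) hp
  -- generic tools
  have supp_of : ∀ (F : ℝ × ℝ → ℝ) (g : ℝ × ℝ → ℝ), HasCompactSupport g → (∀ p, g p = 0 → F p = 0) → HasCompactSupport F :=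
    fun F g hg h => hg.mono fun p hp => by
      contrapose! hp
      simp only [mem_support, ne_eq, not_not] at hp ⊢
      exact h p hp
  have sliceR_supp : ∀ (G : ℝ × ℝ → ℝ), HasCompactSupport G → ∀ θ : ℝ, HasCompactSupport fun R => G (R, θ) :=
    fun G hG θ => HasCompactSupport.of_support_subset_isCompact (hG.image continuous_fst) fun R hR =>
      ⟨(R, θ), subset_tsupport G hR, rfl⟩
  have vanishR : ∀ (G : ℝ × ℝ → ℝ), IntegrableOn G strip → (∀ θ ∈ Ioo 0 (π / 2), ∫ R in Ioi (0 : ℝ), G (R, θ) = 0) →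
      ∫ p in strip, G p = 0 := fun G hG h => by
    rw [integral_strip_eq_integral_Ioo_integral_Ioi' hG]; exact setIntegral_eq_zero_of_forall_eq_zero h
  have vanishθ : ∀ (G : ℝ × ℝ → ℝ), IntegrableOn G strip → (∀ R ∈ Ioi (0 : ℝ), ∫ θ in Ioo 0 (π / 2), G (R, θ) = 0) →
      ∫ p in strip, G p = 0 := fun G hG h => by
    rw [integral_strip_eq_integral_Ioi_integral_Ioo' hG]; exact setIntegral_eq_zero_of_forall_eq_zero h
  have intR : ∀ (G : ℝ × ℝ → ℝ), Continuous G → HasCompactSupport G → ∀ θ, Integrable fun R => G (R, θ) :=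
    fun G hG hGs θ => (hG.comp (Continuous.prodMk_left θ)).integrable_of_hasCompactSupport (sliceR_supp G hGs θ)
  have intθu : ∀ (G : ℝ × ℝ → ℝ), Continuous G → ∀ R,
      IntegrableOn (fun θ => G (R, θ) * Real.sin (2 * θ) ^ (-η)) (Ioo 0 (π / 2)) :=
    fun G hG R => integrableOn_Ioo_continuous_mul_rpow hη0 hη1 (hG.comp (Continuous.prodMk_right R))
  have int2 : ∀ (G : ℝ × ℝ → ℝ), Continuous G → HasCompactSupport G →
      IntegrableOn (fun p : ℝ × ℝ => G p * Real.sin (2 * p.2) ^ (-η)) strip :=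
    fun G hG hGs => integrableOn_strip_mul_rpow_of_continuous hη0 hη1 hG hGs
  -- slices of `Ψ`, `χ`
  have hvR : ∀ θ, ContDiff ℝ 2 fun R => Ψ R θ := fun θ => hΨ2.comp (contDiff_id.prodMk contDiff_const)
  have hgR : ∀ θ, ContDiff ℝ 1 fun R => dθ (dθ Ψ) R θ := fun θ => hdθ2Ψ.comp (contDiff_id.prodMk contDiff_const)
  have hfθ : ∀ R, ContDiff ℝ 2 fun θ => dz Ψ R θ := fun R => hdzΨ.comp (contDiff_const.prodMk contDiff_id)
  have huθ : ∀ R, ContDiff ℝ 1 fun θ => Ψ R θ := fun R => hΨ1.comp (contDiff_const.prodMk contDiff_id)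
  have hχθ : ∀ R, ContDiff ℝ 2 fun θ => χ R θ := fun R => hχ2.comp (contDiff_const.prodMk contDiff_id)
  have hdθχθ : ∀ R, ContDiff ℝ 1 fun θ => dθ χ R θ := fun R => (hdθχ.of_le (by norm_num)).comp (contDiff_const.prodMk contDiff_id)
  have hdv : ∀ θ, deriv (fun R => Ψ R θ) = fun R => dz Ψ R θ := fun θ => rfl
  have hddv : ∀ θ, deriv (deriv fun R => Ψ R θ) = fun R => dz (dz Ψ) R θ := fun θ => by rw [hdv θ]; rfl
  have hdg : ∀ θ, deriv (fun R => dθ (dθ Ψ) R θ) = fun R => dz (dθ (dθ Ψ)) R θ := fun θ => rfl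
  have hdf : ∀ R, deriv (fun θ => dz Ψ R θ) = fun θ => dθ (dz Ψ) R θ := fun R => rfl
  have hddf : ∀ R, deriv (deriv fun θ => dz Ψ R θ) = fun θ => dθ (dθ (dz Ψ)) R θ := fun R => by rw [hdf R]; rfl
  have hdh : ∀ R, deriv (fun θ => χ R θ) = fun θ => dθ χ R θ := fun R => rfl
  have hddh : ∀ R, deriv (deriv fun θ => χ R θ) = fun θ => dθ (dθ χ) R θ := fun R => by rw [hdh R]; rfl
  have hdk : ∀ R, deriv (fun θ => dθ χ R θ) = fun θ => dθ (dθ χ) R θ := fun R => rfl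
  have hgs : ∀ θ, HasCompactSupport fun R => dθ (dθ Ψ) R θ := fun θ => sliceR_supp (fun p => dθ (dθ Ψ) p.1 p.2) hdθ2Ψs θ
  have hgsub : ∀ θ, tsupport (fun R => dθ (dθ Ψ) R θ) ⊆ Ioi 0 := by
    intro θ
    refine (closure_minimal (fun R hR => ?_) isClosed_Ici).trans (Ici_subset_Ioi.2 ha)
    by_contra h
    exact hR (hvadθ2 (R, θ) (not_le.1 h))
  -- the expansion of `∂_θθΨ` and the tangent term
  have hdθ2 : ∀ R θ, dθ (dθ Ψ) R θ = -Real.cos θ * χ R θ - 2 * Real.sin θ * dθ χ R θ + Real.cos θ * dθ (dθ χ) R θ :=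
    fun R θ => by rw [hΨ, dθ_dθ_cosProfile hχ2]
  ----------------------------------------------------------------
  -- the integrands (all of the form `G·sin(2θ)^{−η}`)
  ----------------------------------------------------------------
  obtain ⟨GA, hGA⟩ : ∃ GA : ℝ × ℝ → ℝ, GA = fun p => M p.1 * (dz (dz Ψ) p.1 p.2 * dθ (dθ Ψ) p.1 p.2) := ⟨_, rfl⟩
  obtain ⟨GA1, hGA1⟩ : ∃ GA1 : ℝ × ℝ → ℝ, GA1 = fun p => deriv M p.1 * (dz Ψ p.1 p.2 * dθ (dθ Ψ) p.1 p.2) := ⟨_, rfl⟩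
  obtain ⟨GA5, hGA5⟩ : ∃ GA5 : ℝ × ℝ → ℝ, GA5 = fun p => M p.1 * (dz Ψ p.1 p.2 * dz (dθ (dθ Ψ)) p.1 p.2) := ⟨_, rfl⟩
  obtain ⟨GZ, hGZ⟩ : ∃ GZ : ℝ × ℝ → ℝ, GZ = fun p => M p.1 * dz (dθ Ψ) p.1 p.2 ^ 2 := ⟨_, rfl⟩
  obtain ⟨GA3, hGA3⟩ : ∃ GA3 : ℝ × ℝ → ℝ, GA3 = fun p => M p.1 * dz Ψ p.1 p.2 ^ 2 := ⟨_, rfl⟩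
  obtain ⟨GB, hGB⟩ : ∃ GB : ℝ × ℝ → ℝ, GB = fun p => W p.1 * ((p.1 * dz Ψ p.1 p.2) * dθ (dθ Ψ) p.1 p.2) := ⟨_, rfl⟩
  obtain ⟨GP, hGP⟩ : ∃ GP : ℝ × ℝ → ℝ, GP = fun p => W p.1 * dθ (dθ Ψ) p.1 p.2 ^ 2 := ⟨_, rfl⟩
  obtain ⟨GD, hGD⟩ : ∃ GD : ℝ × ℝ → ℝ, GD = fun p => W p.1 * (-(Real.cos p.2 * χ p.1 p.2 + Real.sin p.2 * dθ χ p.1 p.2) * dθ (dθ Ψ) p.1 p.2) := ⟨_, rfl⟩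
  obtain ⟨GE, hGE⟩ : ∃ GE : ℝ × ℝ → ℝ, GE = fun p => W p.1 * (Ψ p.1 p.2 * dθ (dθ Ψ) p.1 p.2) := ⟨_, rfl⟩
  obtain ⟨GX1, hGX1⟩ : ∃ GX1 : ℝ × ℝ → ℝ, GX1 = fun p => W p.1 * Ψ p.1 p.2 ^ 2 := ⟨_, rfl⟩
  obtain ⟨GX2, hGX2⟩ : ∃ GX2 : ℝ × ℝ → ℝ, GX2 = fun p => W p.1 * (Real.cos (2 * p.2) * χ p.1 p.2 ^ 2) := ⟨_, rfl⟩
  obtain ⟨GQ, hGQ⟩ : ∃ GQ : ℝ × ℝ → ℝ, GQ = fun p => W p.1 * ((Real.cos p.2 ^ 2 + 2 * Real.sin p.2 ^ 2 + (1 / 2) * (1 - η) * Real.cos (2 * p.2)) *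
    dθ χ p.1 p.2 ^ 2) := ⟨_, rfl⟩
  -- the two quotient integrands (bounded, not continuous on the plane)
  obtain ⟨HA4, hHA4⟩ : ∃ HA4 : ℝ × ℝ → ℝ, HA4 = fun p => M p.1 * Real.cos (2 * p.2) ^ 2 * (dz Ψ p.1 p.2 / Real.sin (2 * p.2)) ^ 2 := ⟨_, rfl⟩
  obtain ⟨HX4, hHX4⟩ : ∃ HX4 : ℝ × ℝ → ℝ, HX4 = fun p => W p.1 * Real.cos (2 * p.2) ^ 2 * (Ψ p.1 p.2 / Real.sin (2 * p.2)) ^ 2 := ⟨_, rfl⟩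
  -- continuity and compact support of the `G`'s
  have cGA : Continuous GA := by
    rw [hGA]
    exact continuous_weight_mul₂ hMc (cdz2.mul cdθ2) ha fun p hp => by simp [hvadθ2 p hp]
  have cGA1 : Continuous GA1 := by
    rw [hGA1]
    exact continuous_weight_mul₂ hM'c (cdz.mul cdθ2) ha fun p hp => by simp [hvadz p hp]
  have cGA5 : Continuous GA5 := by
    rw [hGA5]
    exact continuous_weight_mul₂ hMc (cdz.mul cdzdθ2) ha fun p hp => by simp [hvadz p hp]
  have cGZ : Continuous GZ := by
    rw [hGZ]
    exact continuous_weight_mul₂ hMc (cdzdθ.pow 2) ha fun p hp => by simp [vanish_dz (dθ Ψ) hvadθ p hp]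
  have cGA3 : Continuous GA3 := by
    rw [hGA3]
    exact continuous_weight_mul₂ hMc (cdz.pow 2) ha fun p hp => by simp [hvadz p hp]
  have cGB : Continuous GB := by
    rw [hGB]
    exact continuous_weight_mul₂ hWc (by fun_prop) ha fun p hp => by simp [hvadz p hp]
  have cGP : Continuous GP := by
    rw [hGP]
    exact continuous_weight_mul₂ hWc (cdθ2.pow 2) ha fun p hp => by simp [hvadθ2 p hp]
  have cGD : Continuous GD := by
    rw [hGD]
    exact continuous_weight_mul₂ hWc (by fun_prop) ha fun p hp => by simp [hvadθ2 p hp]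
  have cGE : Continuous GE := by
    rw [hGE]
    exact continuous_weight_mul₂ hWc (cΨ.mul cdθ2) ha fun p hp => by simp [hvaΨ p hp]
  have cGX1 : Continuous GX1 := by
    rw [hGX1]
    exact continuous_weight_mul₂ hWc (cΨ.pow 2) ha fun p hp => by simp [hvaΨ p hp]
  have cGX2 : Continuous GX2 := by
    rw [hGX2]
    exact continuous_weight_mul₂ hWc (by fun_prop) ha fun p hp => by simp [hvaχ p hp]
  have cGQ : Continuous GQ := by
    rw [hGQ]
    exact continuous_weight_mul₂ hWc (by fun_prop) ha fun p hp => by simp [hvadθχ p hp]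
  have sGA : HasCompactSupport GA := supp_of GA _ hdθ2Ψs fun p hp => by simp only [hGA]; simp [show dθ (dθ Ψ) p.1 p.2 = 0 from hp]
  have sGA1 : HasCompactSupport GA1 := supp_of GA1 _ hdzΨs fun p hp => by simp only [hGA1]; simp [show dz Ψ p.1 p.2 = 0 from hp]
  have sGA5 : HasCompactSupport GA5 := supp_of GA5 _ hdzΨs fun p hp => by simp only [hGA5]; simp [show dz Ψ p.1 p.2 = 0 from hp]
  have sGZ : HasCompactSupport GZ := supp_of GZ _ hdzdθΨs fun p hp => by simp only [hGZ]; simp [show dz (dθ Ψ) p.1 p.2 = 0 from hp]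
  have sGA3 : HasCompactSupport GA3 := supp_of GA3 _ hdzΨs fun p hp => by simp only [hGA3]; simp [show dz Ψ p.1 p.2 = 0 from hp]
  have sGB : HasCompactSupport GB := supp_of GB _ hdzΨs fun p hp => by simp only [hGB]; simp [show dz Ψ p.1 p.2 = 0 from hp]
  have sGP : HasCompactSupport GP := supp_of GP _ hdθ2Ψs fun p hp => by simp only [hGP]; simp [show dθ (dθ Ψ) p.1 p.2 = 0 from hp]
  have sGD : HasCompactSupport GD := supp_of GD _ hdθ2Ψs fun p hp => by simp only [hGD]; simp [show dθ (dθ Ψ) p.1 p.2 = 0 from hp]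
  have sGE : HasCompactSupport GE := supp_of GE _ hΨs fun p hp => by simp only [hGE]; simp [show Ψ p.1 p.2 = 0 from hp]
  have sGX1 : HasCompactSupport GX1 := supp_of GX1 _ hΨs fun p hp => by simp only [hGX1]; simp [show Ψ p.1 p.2 = 0 from hp]
  have sGX2 : HasCompactSupport GX2 := supp_of GX2 _ hs fun p hp => by simp only [hGX2]; simp [show χ p.1 p.2 = 0 from hp]
  have sGQ : HasCompactSupport GQ := supp_of GQ _ hdθχs fun p hp => by simp only [hGQ]; simp [show dθ χ p.1 p.2 = 0 from hp]
  -- plane integrability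
  have iA := int2 GA cGA sGA
  have iA1 := int2 GA1 cGA1 sGA1
  have iA5 := int2 GA5 cGA5 sGA5
  have iZ := int2 GZ cGZ sGZ
  have iA3 := int2 GA3 cGA3 sGA3
  have iB := int2 GB cGB sGB
  have iP := int2 GP cGP sGP
  have iD := int2 GD cGD sGD
  have iE := int2 GE cGE sGE
  have iX1 := int2 GX1 cGX1 sGX1
  have iX2 := int2 GX2 cGX2 sGX2
  have iQ := int2 GQ cGQ sGQ
  -- the quotient integrands: bounded by `CM K₂²`, `CW K₁²` on the strip and radially supported in `[a, B]`
  have hRrange : ∀ p ∈ strip, dz Ψ p.1 p.2 ≠ 0 ∨ Ψ p.1 p.2 ≠ 0 → p.1 ∈ Icc a (max a B) := by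
    intro p hp h
    constructor
    · by_contra hlt
      rcases h with h | h
      · exact h (hvadz p (not_le.1 hlt))
      · exact h (hvaΨ p (not_le.1 hlt))
    · by_contra hlt
      have hB' : B < p.1 := lt_of_le_of_lt (le_max_right _ _) (not_le.1 hlt)
      rcases h with h | h
      · exact h (hBdz p hB')
      · exact h (hB p hB')
  have hquotA : ∀ p ∈ strip, |dz Ψ p.1 p.2 / Real.sin (2 * p.2)| ≤ K₂ := fun p hp => by
    rw [abs_div, abs_of_pos (hsin p hp), div_le_iff₀ (hsin p hp)]
    exact hdzK p.1 p.2 (Ioo_subset_Icc_self hp.2)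
  have hquotX : ∀ p ∈ strip, |Ψ p.1 p.2 / Real.sin (2 * p.2)| ≤ K₁ := fun p hp => by
    rw [abs_div, abs_of_pos (hsin p hp), div_le_iff₀ (hsin p hp)]
    exact hΨK p.1 p.2 (Ioo_subset_Icc_self hp.2)
  have cHA4 : ContinuousOn HA4 strip := by
    simp only [hHA4, hM]
    refine ContinuousOn.mul (ContinuousOn.mul ?_ (by fun_prop)) ?_
    · exact ((continuousOn_id.pow 2).mul hWc).comp continuous_fst.continuousOn fun p hp => hp.1
    · refine ContinuousOn.pow (ContinuousOn.div cdz.continuousOn (by fun_prop) fun p hp => (hsin p hp).ne') 2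
  have cHX4 : ContinuousOn HX4 strip := by
    simp only [hHX4]
    refine ContinuousOn.mul (ContinuousOn.mul ?_ (by fun_prop)) ?_
    · exact hWc.comp continuous_fst.continuousOn fun p hp => hp.1
    · refine ContinuousOn.pow (ContinuousOn.div cΨ.continuousOn (by fun_prop) fun p hp => (hsin p hp).ne') 2
  have iA4 : IntegrableOn (fun p : ℝ × ℝ => HA4 p * Real.sin (2 * p.2) ^ (-η)) strip := by
    refine integrableOn_strip_mul_rpow hη0 hη1 (cHA4.aestronglyMeasurable measurableSet_strip) (C := CM * K₂ ^ 2)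
      (B := max a B) (fun p hp => ?_) (fun p hp hgt => ?_)
    · simp only [hHA4]
      by_cases hz : dz Ψ p.1 p.2 = 0
      · rw [hz]; simp; positivity
      · have hR := hRrange p hp (Or.inl hz)
        have h1 : |M p.1| ≤ CM := by have := hCM p.1 hR; rwa [Real.norm_eq_abs] at this
        have h2 : |Real.cos (2 * p.2) ^ 2| ≤ 1 := by
          rw [abs_of_nonneg (sq_nonneg _), ← sq_abs]; nlinarith [abs_nonneg (Real.cos (2 * p.2)), Real.abs_cos_le_one (2 * p.2)]
        have h3 : |(dz Ψ p.1 p.2 / Real.sin (2 * p.2)) ^ 2| ≤ K₂ ^ 2 := by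
          rw [abs_of_nonneg (sq_nonneg _), ← sq_abs]; exact pow_le_pow_left₀ (abs_nonneg _) (hquotA p hp) 2
        calc _ ≤ CM * 1 * K₂ ^ 2 := abs_mul₃_le h1 h2 h3 hCM0 zero_le_one
          _ = _ := by ring
    · simp only [hHA4]
      rw [hBdz p (lt_of_le_of_lt (le_max_right _ _) hgt)]; simp
  have iX4 : IntegrableOn (fun p : ℝ × ℝ => HX4 p * Real.sin (2 * p.2) ^ (-η)) strip := by
    refine integrableOn_strip_mul_rpow hη0 hη1 (cHX4.aestronglyMeasurable measurableSet_strip) (C := CW * K₁ ^ 2)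
      (B := max a B) (fun p hp => ?_) (fun p hp hgt => ?_)
    · simp only [hHX4]
      by_cases hz : Ψ p.1 p.2 = 0
      · rw [hz]; simp; positivity
      · have hR := hRrange p hp (Or.inr hz)
        have h1 : |W p.1| ≤ CW := by have := hCW p.1 hR; rwa [Real.norm_eq_abs] at this
        have h2 : |Real.cos (2 * p.2) ^ 2| ≤ 1 := by
          rw [abs_of_nonneg (sq_nonneg _), ← sq_abs]; nlinarith [abs_nonneg (Real.cos (2 * p.2)), Real.abs_cos_le_one (2 * p.2)]
        have h3 : |(Ψ p.1 p.2 / Real.sin (2 * p.2)) ^ 2| ≤ K₁ ^ 2 := by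
          rw [abs_of_nonneg (sq_nonneg _), ← sq_abs]; exact pow_le_pow_left₀ (abs_nonneg _) (hquotX p hp) 2
        calc _ ≤ CW * 1 * K₁ ^ 2 := abs_mul₃_le h1 h2 h3 hCW0 zero_le_one
          _ = _ := by ring
    · simp only [hHX4]
      have hz : Ψ p.1 p.2 = 0 := hB p (lt_of_le_of_lt (le_max_right _ _) hgt)
      rw [hz]; simp
  ----------------------------------------------------------------
  -- pointwise expansion of the left-hand side on the strip
  ----------------------------------------------------------------
  have hpt : ∀ p ∈ strip, ellipticOp α Ψ p.1 p.2 * (-dθ (dθ Ψ) p.1 p.2) * W p.1 * Real.sin (2 * p.2) ^ (-η) =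
      α ^ 2 * (GA p * Real.sin (2 * p.2) ^ (-η)) + α * (5 + α) * (GB p * Real.sin (2 * p.2) ^ (-η)) + GP p * Real.sin (2 * p.2) ^ (-η) + GD p * Real.sin (2 * p.2) ^ (-η) + 6 * (GE p * Real.sin (2 * p.2) ^ (-η)) := by
    intro p hp
    have hcos : Real.cos p.2 ≠ 0 := (Real.cos_pos_of_mem_Ioo ⟨by linarith [hp.2.1, Real.pi_pos], hp.2.2⟩).ne'
    have hT : Real.cos p.2 * χ p.1 p.2 / Real.cos p.2 ^ 2 +
        Real.sin p.2 * (-Real.sin p.2 * χ p.1 p.2 + Real.cos p.2 * dθ χ p.1 p.2) / Real.cos p.2 =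
        Real.cos p.2 * χ p.1 p.2 + Real.sin p.2 * dθ χ p.1 p.2 := by
      rw [div_add_div _ _ (pow_ne_zero 2 hcos) hcos, div_eq_iff (mul_ne_zero (pow_ne_zero 2 hcos) hcos)]
      have := Real.sin_sq_add_cos_sq p.2
      linear_combination (-(Real.cos p.2 ^ 2 * χ p.1 p.2)) * this
    have hΨp : Ψ p.1 p.2 = Real.cos p.2 * χ p.1 p.2 := by rw [hΨ]
    have hdθp : dθ Ψ p.1 p.2 = -Real.sin p.2 * χ p.1 p.2 + Real.cos p.2 * dθ χ p.1 p.2 := by rw [hΨ, dθ_cosProfile hχ1]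
    have hud : DifferentiableAt ℝ (fun θ' => Ψ p.1 θ') p.2 :=
      ((hΨ2.comp (contDiff_const.prodMk contDiff_id)).differentiable (by simp)) p.2
    rw [ellipticOp_eq_expanded α hud hcos]
    simp only [hGA, hGB, hGP, hGD, hGE, hM]
    rw [hdθp, hΨp, hT]
    ring
  ----------------------------------------------------------------
  -- (IA-a) the radial integration by parts: `∫∫ GA u = −∫∫ GA1 u − ∫∫ GA5 u`
  ----------------------------------------------------------------
  have hMderiv : ∀ R, 0 < R → HasDerivAt M (deriv M R) R := fun R hR =>
    (hMd.differentiableOn (by simp) |>.differentiableAt (Ioi_mem_nhds hR)).hasDerivAt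
  have hIAa : ∫ p in strip, GA p * Real.sin (2 * p.2) ^ (-η) = -(∫ p in strip, GA1 p * Real.sin (2 * p.2) ^ (-η)) - ∫ p in strip, GA5 p * Real.sin (2 * p.2) ^ (-η) := by
    have h0 := vanishR (fun p => GA p * Real.sin (2 * p.2) ^ (-η) + GA1 p * Real.sin (2 * p.2) ^ (-η) + GA5 p * Real.sin (2 * p.2) ^ (-η)) ((iA.add iA1).add iA5) (fun θ hθ => by
      have h1 := integral_Ioi_weight_mul_deriv2_mul_polar hMd (hvR θ) (hgR θ) (hgs θ) (hgsub θ)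
      rw [hddv θ, hdv θ, hdg θ] at h1
      simp only at h1
      have j1 : Integrable fun R => GA (R, θ) * Real.sin (2 * θ) ^ (-η) := (intR GA cGA sGA θ).mul_const (Real.sin (2 * θ) ^ (-η))
      have j2 : Integrable fun R => GA1 (R, θ) * Real.sin (2 * θ) ^ (-η) := (intR GA1 cGA1 sGA1 θ).mul_const (Real.sin (2 * θ) ^ (-η))
      have j3 : Integrable fun R => GA5 (R, θ) * Real.sin (2 * θ) ^ (-η) := (intR GA5 cGA5 sGA5 θ).mul_const (Real.sin (2 * θ) ^ (-η))
      have j12 : Integrable fun R => GA (R, θ) * Real.sin (2 * θ) ^ (-η) + GA1 (R, θ) * Real.sin (2 * θ) ^ (-η) := j1.add j2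
      rw [integral_add j12.integrableOn j3.integrableOn, integral_add j1.integrableOn j2.integrableOn]
      simp only [hGA, hGA1, hGA5]
      have e1 : ∫ R in Ioi (0 : ℝ), M R * (dz (dz Ψ) R θ * dθ (dθ Ψ) R θ) * Real.sin (2 * θ) ^ (-η) =
          Real.sin (2 * θ) ^ (-η) * ∫ R in Ioi (0 : ℝ), M R * dz (dz Ψ) R θ * dθ (dθ Ψ) R θ := by
        rw [← MeasureTheory.integral_const_mul]; exact integral_congr_ae (ae_of_all _ fun R => by ring)
      have e2 : ∫ R in Ioi (0 : ℝ), deriv M R * (dz Ψ R θ * dθ (dθ Ψ) R θ) * Real.sin (2 * θ) ^ (-η) =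
          Real.sin (2 * θ) ^ (-η) * ∫ R in Ioi (0 : ℝ), deriv M R * dz Ψ R θ * dθ (dθ Ψ) R θ := by
        rw [← MeasureTheory.integral_const_mul]; exact integral_congr_ae (ae_of_all _ fun R => by ring)
      have e3 : ∫ R in Ioi (0 : ℝ), M R * (dz Ψ R θ * dz (dθ (dθ Ψ)) R θ) * Real.sin (2 * θ) ^ (-η) =
          Real.sin (2 * θ) ^ (-η) * ∫ R in Ioi (0 : ℝ), M R * dz Ψ R θ * dz (dθ (dθ Ψ)) R θ := by
        rw [← MeasureTheory.integral_const_mul]; exact integral_congr_ae (ae_of_all _ fun R => by ring)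
      rw [e1, e2, e3, h1]; ring)
    have k12 : IntegrableOn (fun p => GA p * Real.sin (2 * p.2) ^ (-η) + GA1 p * Real.sin (2 * p.2) ^ (-η)) strip := iA.add iA1
    rw [integral_add k12 iA5, integral_add iA iA1] at h0
    linear_combination h0
  ----------------------------------------------------------------
  -- (IA-b) the angular integrations by parts on `∂_RΨ(R,·)`:
  -- `∫∫ GA5 u = −∫∫ GZ u + 2η∫∫ GA3 u + 2η(1+η)∫∫ HA4 u`
  ----------------------------------------------------------------
  have hIAb : ∫ p in strip, GA5 p * Real.sin (2 * p.2) ^ (-η) = -(∫ p in strip, GZ p * Real.sin (2 * p.2) ^ (-η)) + 2 * η * (∫ p in strip, GA3 p * Real.sin (2 * p.2) ^ (-η)) +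
      2 * η * (1 + η) * ∫ p in strip, HA4 p * Real.sin (2 * p.2) ^ (-η) := by
    have h0 := vanishθ (fun p => GA5 p * Real.sin (2 * p.2) ^ (-η) + GZ p * Real.sin (2 * p.2) ^ (-η) - 2 * η * (GA3 p * Real.sin (2 * p.2) ^ (-η)) - 2 * η * (1 + η) * (HA4 p * Real.sin (2 * p.2) ^ (-η)))
      (((iA5.add iZ).sub (iA3.const_mul _)).sub (iA4.const_mul _)) (fun R hR => by
      -- the Dirichlet slice `f = ∂_RΨ(R,·)`
      have hL1 := integral_Ioo_rpow_mul_mul_deriv2 hη0 hη1 (hfθ R) (hE0 R) (hE1 R)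
      have hL2 := integral_Ioo_cos_rpow_inv_mul_mul_deriv hη0 hη1 ((hfθ R).of_le (by norm_num)) (hE0 R) (hE1 R)
      rw [hddf R, hdf R] at hL1
      rw [hdf R] at hL2
      simp only at hL1 hL2
      -- replace the mixed partials on the slice (`R > 0`, `θ ∈ (0, π/2)`)
      have eA5 : ∫ θ in Ioo 0 (π / 2), GA5 (R, θ) * Real.sin (2 * θ) ^ (-η) =
          M R * ∫ θ in Ioo 0 (π / 2), Real.sin (2 * θ) ^ (-η) * dz Ψ R θ * dθ (dθ (dz Ψ)) R θ := by
        rw [← MeasureTheory.integral_const_mul]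
        refine setIntegral_congr_fun measurableSet_Ioo fun θ hθ => ?_
        simp only [hGA5]
        rw [hcommA (R, θ) ⟨hR, hθ⟩]; ring
      have eZ : ∫ θ in Ioo 0 (π / 2), GZ (R, θ) * Real.sin (2 * θ) ^ (-η) =
          M R * ∫ θ in Ioo 0 (π / 2), Real.sin (2 * θ) ^ (-η) * dθ (dz Ψ) R θ ^ 2 := by
        rw [← MeasureTheory.integral_const_mul]
        refine setIntegral_congr_fun measurableSet_Ioo fun θ hθ => ?_
        simp only [hGZ]
        rw [hcomm1 (R, θ) ⟨hR, hθ⟩]; ring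
      have eA3 : ∫ θ in Ioo 0 (π / 2), GA3 (R, θ) * Real.sin (2 * θ) ^ (-η) =
          M R * ∫ θ in Ioo 0 (π / 2), Real.sin (2 * θ) ^ (-η) * dz Ψ R θ ^ 2 := by
        rw [← MeasureTheory.integral_const_mul]
        exact integral_congr_ae (ae_of_all _ fun θ => by simp only [hGA3]; ring)
      have eA4 : ∫ θ in Ioo 0 (π / 2), HA4 (R, θ) * Real.sin (2 * θ) ^ (-η) =
          M R * ∫ θ in Ioo 0 (π / 2), Real.cos (2 * θ) ^ 2 * Real.sin (2 * θ) ^ (-η) * (dz Ψ R θ / Real.sin (2 * θ)) ^ 2 := by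
        rw [← MeasureTheory.integral_const_mul]
        exact integral_congr_ae (ae_of_all _ fun θ => by simp only [hHA4]; ring)
      have j1 : IntegrableOn (fun θ => GA5 (R, θ) * Real.sin (2 * θ) ^ (-η)) (Ioo 0 (π / 2)) := intθu GA5 cGA5 R
      have j2 : IntegrableOn (fun θ => GZ (R, θ) * Real.sin (2 * θ) ^ (-η)) (Ioo 0 (π / 2)) := intθu GZ cGZ R
      have j3 : IntegrableOn (fun θ => 2 * η * (GA3 (R, θ) * Real.sin (2 * θ) ^ (-η))) (Ioo 0 (π / 2)) := (intθu GA3 cGA3 R).const_mul _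
      have j4 : IntegrableOn (fun θ => 2 * η * (1 + η) * (HA4 (R, θ) * Real.sin (2 * θ) ^ (-η))) (Ioo 0 (π / 2)) := by
        obtain ⟨Kf, hKf0, hKf⟩ := exists_abs_le_mul_sin_two_mul ((hfθ R).of_le (by norm_num)) (hE0 R) (hE1 R)
        have hm : Measurable fun θ => HA4 (R, θ) := by
          simp only [hHA4]
          have : Measurable fun θ => dz Ψ R θ := (cdz.comp (Continuous.prodMk_right R)).measurable
          fun_prop
        refine (integrableOn_mul_sin_two_mul_rpow_of_abs_le hη0 hη1 hm (C := |M R| * Kf ^ 2) fun θ hθ => ?_).const_mul _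
        simp only [hHA4]
        have hsθ : 0 < Real.sin (2 * θ) := Real.sin_pos_of_pos_of_lt_pi (by linarith [hθ.1]) (by linarith [hθ.2])
        have h2 : |Real.cos (2 * θ) ^ 2| ≤ 1 := by
          rw [abs_of_nonneg (sq_nonneg _), ← sq_abs]; nlinarith [abs_nonneg (Real.cos (2 * θ)), Real.abs_cos_le_one (2 * θ)]
        have hq : |dz Ψ R θ / Real.sin (2 * θ)| ≤ Kf := by
          rw [abs_div, abs_of_pos hsθ, div_le_iff₀ hsθ]; exact hKf θ (Ioo_subset_Icc_self hθ)
        have h3 : |(dz Ψ R θ / Real.sin (2 * θ)) ^ 2| ≤ Kf ^ 2 := by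
          rw [abs_of_nonneg (sq_nonneg _), ← sq_abs]; exact pow_le_pow_left₀ (abs_nonneg _) hq 2
        calc _ ≤ |M R| * 1 * Kf ^ 2 := abs_mul₃_le le_rfl h2 h3 (abs_nonneg _) zero_le_one
          _ = _ := by ring
      have j12 : IntegrableOn (fun θ => GA5 (R, θ) * Real.sin (2 * θ) ^ (-η) + GZ (R, θ) * Real.sin (2 * θ) ^ (-η)) (Ioo 0 (π / 2)) := j1.add j2
      have j123 : IntegrableOn (fun θ => GA5 (R, θ) * Real.sin (2 * θ) ^ (-η) + GZ (R, θ) * Real.sin (2 * θ) ^ (-η) - 2 * η * (GA3 (R, θ) * Real.sin (2 * θ) ^ (-η)))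
          (Ioo 0 (π / 2)) := j12.sub j3
      rw [integral_sub j123 j4, integral_sub j12 j3, integral_add j1 j2, MeasureTheory.integral_const_mul,
        MeasureTheory.integral_const_mul, eA5, eZ, eA3, eA4, hL1, hL2]
      ring)
    have k1 : IntegrableOn (fun p => GA5 p * Real.sin (2 * p.2) ^ (-η) + GZ p * Real.sin (2 * p.2) ^ (-η)) strip := iA5.add iZ
    have k2 : IntegrableOn (fun p => 2 * η * (GA3 p * Real.sin (2 * p.2) ^ (-η))) strip := iA3.const_mul _
    have k3 : IntegrableOn (fun p => 2 * η * (1 + η) * (HA4 p * Real.sin (2 * p.2) ^ (-η))) strip := iA4.const_mul _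
    have k12 : IntegrableOn (fun p => GA5 p * Real.sin (2 * p.2) ^ (-η) + GZ p * Real.sin (2 * p.2) ^ (-η) - 2 * η * (GA3 p * Real.sin (2 * p.2) ^ (-η))) strip := k1.sub k2
    rw [integral_sub k12 k3, integral_sub k1 k2, integral_add iA5 iZ, MeasureTheory.integral_const_mul,
      MeasureTheory.integral_const_mul] at h0
    linear_combination h0
  ----------------------------------------------------------------
  -- (ID) the tangent term: `∫∫ GD u = (1−2η)∫∫ GX1 u − ½(1+η)∫∫ GX2 u + ∫∫ GQ u − 2η(1+η)∫∫ HX4 u`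
  ----------------------------------------------------------------
  have hID : ∫ p in strip, GD p * Real.sin (2 * p.2) ^ (-η) = (1 - 2 * η) * (∫ p in strip, GX1 p * Real.sin (2 * p.2) ^ (-η)) -
      (1 / 2) * (1 + η) * (∫ p in strip, GX2 p * Real.sin (2 * p.2) ^ (-η)) + (∫ p in strip, GQ p * Real.sin (2 * p.2) ^ (-η)) -
      2 * η * (1 + η) * ∫ p in strip, HX4 p * Real.sin (2 * p.2) ^ (-η) := by
    have h0 := vanishθ (fun p => GD p * Real.sin (2 * p.2) ^ (-η) - (1 - 2 * η) * (GX1 p * Real.sin (2 * p.2) ^ (-η)) + (1 / 2) * (1 + η) * (GX2 p * Real.sin (2 * p.2) ^ (-η)) -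
        GQ p * Real.sin (2 * p.2) ^ (-η) + 2 * η * (1 + η) * (HX4 p * Real.sin (2 * p.2) ^ (-η)))
      ((((iD.sub (iX1.const_mul _)).add (iX2.const_mul _)).sub iQ).add (iX4.const_mul _)) (fun R hR => by
      -- the slices `h = χ(R,·)`, `k = ∂_θχ(R,·)`
      have hL4 := integral_Ioo_cos_sq_rpow_mul_mul_deriv2 hη0 hη1 (hχθ R) (hχ0 R)
      have hL3h := integral_Ioo_sin_rpow_mul_mul_deriv hη0 hη1 ((hχθ R).of_le (by norm_num))
      have hL3k := integral_Ioo_sin_rpow_mul_mul_deriv hη0 hη1 (hdθχθ R)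
      have hL6 := integral_Ioo_cos_cos_sq_rpow_inv_mul_mul_deriv hη0 hη1 ((hχθ R).of_le (by norm_num)) (hχ0 R)
      rw [hddh R, hdh R] at hL4
      rw [hdh R] at hL3h hL6
      rw [hdk R] at hL3k
      simp only at hL4 hL3h hL3k hL6
      -- the pointwise expansion of the tangent term on the slice
      have eD : ∫ θ in Ioo 0 (π / 2), GD (R, θ) * Real.sin (2 * θ) ^ (-η) =
          W R * ((∫ θ in Ioo 0 (π / 2), Real.cos θ ^ 2 * Real.sin (2 * θ) ^ (-η) * χ R θ ^ 2) +
            (3 / 2) * (∫ θ in Ioo 0 (π / 2), Real.sin (2 * θ) * Real.sin (2 * θ) ^ (-η) * χ R θ * dθ χ R θ) -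
            (∫ θ in Ioo 0 (π / 2), Real.cos θ ^ 2 * Real.sin (2 * θ) ^ (-η) * χ R θ * dθ (dθ χ) R θ) +
            2 * (∫ θ in Ioo 0 (π / 2), Real.sin θ ^ 2 * Real.sin (2 * θ) ^ (-η) * dθ χ R θ ^ 2) -
            (1 / 2) * (∫ θ in Ioo 0 (π / 2), Real.sin (2 * θ) * Real.sin (2 * θ) ^ (-η) * dθ χ R θ * dθ (dθ χ) R θ)) := by
        have epw : ∀ θ : ℝ, GD (R, θ) * Real.sin (2 * θ) ^ (-η) =
            W R * (Real.cos θ ^ 2 * Real.sin (2 * θ) ^ (-η) * χ R θ ^ 2 +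
              (3 / 2) * (Real.sin (2 * θ) * Real.sin (2 * θ) ^ (-η) * χ R θ * dθ χ R θ) -
              Real.cos θ ^ 2 * Real.sin (2 * θ) ^ (-η) * χ R θ * dθ (dθ χ) R θ +
              2 * (Real.sin θ ^ 2 * Real.sin (2 * θ) ^ (-η) * dθ χ R θ ^ 2) -
              (1 / 2) * (Real.sin (2 * θ) * Real.sin (2 * θ) ^ (-η) * dθ χ R θ * dθ (dθ χ) R θ)) := by
          intro θ
          simp only [hGD]
          rw [hdθ2 R θ, Real.sin_two_mul]
          ring
        simp_rw [epw]
        rw [MeasureTheory.integral_const_mul]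
        congr 1
        have c1 : Continuous fun θ => Real.cos θ ^ 2 * χ R θ ^ 2 := by
          have := cχ.comp (Continuous.prodMk_right R); fun_prop
        have c2 : Continuous fun θ => Real.sin (2 * θ) * χ R θ * dθ χ R θ := by
          have := cχ.comp (Continuous.prodMk_right R); have := cdθχ.comp (Continuous.prodMk_right R); fun_prop
        have c3 : Continuous fun θ => Real.cos θ ^ 2 * χ R θ * dθ (dθ χ) R θ := by
          have := cχ.comp (Continuous.prodMk_right R); have := cdθ2χ.comp (Continuous.prodMk_right R); fun_prop
        have c4 : Continuous fun θ => Real.sin θ ^ 2 * dθ χ R θ ^ 2 := by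
          have := cdθχ.comp (Continuous.prodMk_right R); fun_prop
        have c5 : Continuous fun θ => Real.sin (2 * θ) * dθ χ R θ * dθ (dθ χ) R θ := by
          have := cdθχ.comp (Continuous.prodMk_right R); have := cdθ2χ.comp (Continuous.prodMk_right R); fun_prop
        have k1 : IntegrableOn (fun θ => Real.cos θ ^ 2 * Real.sin (2 * θ) ^ (-η) * χ R θ ^ 2) (Ioo 0 (π / 2)) :=
          (integrableOn_Ioo_continuous_mul_rpow hη0 hη1 c1).congr (ae_of_all _ fun θ => by ring)
        have k2 : IntegrableOn (fun θ => (3 / 2) * (Real.sin (2 * θ) * Real.sin (2 * θ) ^ (-η) * χ R θ * dθ χ R θ))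
            (Ioo 0 (π / 2)) :=
          ((integrableOn_Ioo_continuous_mul_rpow hη0 hη1 c2).congr (ae_of_all _ fun θ => by ring)).const_mul _
        have k3 : IntegrableOn (fun θ => Real.cos θ ^ 2 * Real.sin (2 * θ) ^ (-η) * χ R θ * dθ (dθ χ) R θ) (Ioo 0 (π / 2)) :=
          (integrableOn_Ioo_continuous_mul_rpow hη0 hη1 c3).congr (ae_of_all _ fun θ => by ring)
        have k4 : IntegrableOn (fun θ => 2 * (Real.sin θ ^ 2 * Real.sin (2 * θ) ^ (-η) * dθ χ R θ ^ 2)) (Ioo 0 (π / 2)) :=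
          ((integrableOn_Ioo_continuous_mul_rpow hη0 hη1 c4).congr (ae_of_all _ fun θ => by ring)).const_mul _
        have k5 : IntegrableOn (fun θ => (1 / 2) * (Real.sin (2 * θ) * Real.sin (2 * θ) ^ (-η) * dθ χ R θ * dθ (dθ χ) R θ))
            (Ioo 0 (π / 2)) :=
          ((integrableOn_Ioo_continuous_mul_rpow hη0 hη1 c5).congr (ae_of_all _ fun θ => by ring)).const_mul _
        have k12 : IntegrableOn (fun θ => Real.cos θ ^ 2 * Real.sin (2 * θ) ^ (-η) * χ R θ ^ 2 +
            (3 / 2) * (Real.sin (2 * θ) * Real.sin (2 * θ) ^ (-η) * χ R θ * dθ χ R θ)) (Ioo 0 (π / 2)) := k1.add k2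
        have k123 : IntegrableOn (fun θ => Real.cos θ ^ 2 * Real.sin (2 * θ) ^ (-η) * χ R θ ^ 2 +
            (3 / 2) * (Real.sin (2 * θ) * Real.sin (2 * θ) ^ (-η) * χ R θ * dθ χ R θ) -
            Real.cos θ ^ 2 * Real.sin (2 * θ) ^ (-η) * χ R θ * dθ (dθ χ) R θ) (Ioo 0 (π / 2)) := k12.sub k3
        have k1234 : IntegrableOn (fun θ => Real.cos θ ^ 2 * Real.sin (2 * θ) ^ (-η) * χ R θ ^ 2 +
            (3 / 2) * (Real.sin (2 * θ) * Real.sin (2 * θ) ^ (-η) * χ R θ * dθ χ R θ) -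
            Real.cos θ ^ 2 * Real.sin (2 * θ) ^ (-η) * χ R θ * dθ (dθ χ) R θ +
            2 * (Real.sin θ ^ 2 * Real.sin (2 * θ) ^ (-η) * dθ χ R θ ^ 2)) (Ioo 0 (π / 2)) := k123.add k4
        rw [integral_sub k1234 k5, integral_add k123 k4, integral_sub k12 k3, integral_add k1 k2,
          MeasureTheory.integral_const_mul, MeasureTheory.integral_const_mul, MeasureTheory.integral_const_mul]
      have eX1 : ∫ θ in Ioo 0 (π / 2), GX1 (R, θ) * Real.sin (2 * θ) ^ (-η) =
          W R * ∫ θ in Ioo 0 (π / 2), Real.cos θ ^ 2 * Real.sin (2 * θ) ^ (-η) * χ R θ ^ 2 := by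
        rw [← MeasureTheory.integral_const_mul]
        exact integral_congr_ae (ae_of_all _ fun θ => by simp only [hGX1]; rw [hΨ]; ring)
      have eX2 : ∫ θ in Ioo 0 (π / 2), GX2 (R, θ) * Real.sin (2 * θ) ^ (-η) =
          W R * ∫ θ in Ioo 0 (π / 2), Real.cos (2 * θ) * Real.sin (2 * θ) ^ (-η) * χ R θ ^ 2 := by
        rw [← MeasureTheory.integral_const_mul]
        exact integral_congr_ae (ae_of_all _ fun θ => by simp only [hGX2]; ring)
      have eQ : ∫ θ in Ioo 0 (π / 2), GQ (R, θ) * Real.sin (2 * θ) ^ (-η) =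
          W R * ((∫ θ in Ioo 0 (π / 2), Real.cos θ ^ 2 * Real.sin (2 * θ) ^ (-η) * dθ χ R θ ^ 2) +
            2 * (∫ θ in Ioo 0 (π / 2), Real.sin θ ^ 2 * Real.sin (2 * θ) ^ (-η) * dθ χ R θ ^ 2) +
            (1 / 2) * (1 - η) * ∫ θ in Ioo 0 (π / 2), Real.cos (2 * θ) * Real.sin (2 * θ) ^ (-η) * dθ χ R θ ^ 2) := by
        have epw : ∀ θ : ℝ, GQ (R, θ) * Real.sin (2 * θ) ^ (-η) = W R * (Real.cos θ ^ 2 * Real.sin (2 * θ) ^ (-η) * dθ χ R θ ^ 2 +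
            2 * (Real.sin θ ^ 2 * Real.sin (2 * θ) ^ (-η) * dθ χ R θ ^ 2) +
            (1 / 2) * (1 - η) * (Real.cos (2 * θ) * Real.sin (2 * θ) ^ (-η) * dθ χ R θ ^ 2)) := by
          intro θ; simp only [hGQ]; ring
        simp_rw [epw]
        rw [MeasureTheory.integral_const_mul]
        congr 1
        have cd : Continuous fun θ => dθ χ R θ := cdθχ.comp (Continuous.prodMk_right R)
        have k1 : IntegrableOn (fun θ => Real.cos θ ^ 2 * Real.sin (2 * θ) ^ (-η) * dθ χ R θ ^ 2) (Ioo 0 (π / 2)) :=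
          (integrableOn_Ioo_continuous_mul_rpow hη0 hη1 (by fun_prop : Continuous fun θ => Real.cos θ ^ 2 * dθ χ R θ ^ 2)).congr
            (ae_of_all _ fun θ => by ring)
        have k2 : IntegrableOn (fun θ => 2 * (Real.sin θ ^ 2 * Real.sin (2 * θ) ^ (-η) * dθ χ R θ ^ 2)) (Ioo 0 (π / 2)) :=
          ((integrableOn_Ioo_continuous_mul_rpow hη0 hη1 (by fun_prop : Continuous fun θ => Real.sin θ ^ 2 * dθ χ R θ ^ 2)).congr
            (ae_of_all _ fun θ => by ring)).const_mul _
        have k3 : IntegrableOn (fun θ => (1 / 2) * (1 - η) * (Real.cos (2 * θ) * Real.sin (2 * θ) ^ (-η) * dθ χ R θ ^ 2))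
            (Ioo 0 (π / 2)) :=
          ((integrableOn_Ioo_continuous_mul_rpow hη0 hη1 (by fun_prop : Continuous fun θ => Real.cos (2 * θ) * dθ χ R θ ^ 2)).congr
            (ae_of_all _ fun θ => by ring)).const_mul _
        have k12 : IntegrableOn (fun θ => Real.cos θ ^ 2 * Real.sin (2 * θ) ^ (-η) * dθ χ R θ ^ 2 +
            2 * (Real.sin θ ^ 2 * Real.sin (2 * θ) ^ (-η) * dθ χ R θ ^ 2)) (Ioo 0 (π / 2)) := k1.add k2
        rw [integral_add k12 k3, integral_add k1 k2, MeasureTheory.integral_const_mul, MeasureTheory.integral_const_mul]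
      have eX4 : ∫ θ in Ioo 0 (π / 2), HX4 (R, θ) * Real.sin (2 * θ) ^ (-η) =
          W R * ∫ θ in Ioo 0 (π / 2), Real.cos (2 * θ) ^ 2 * Real.sin (2 * θ) ^ (-η) *
            (Real.cos θ * χ R θ / Real.sin (2 * θ)) ^ 2 := by
        rw [← MeasureTheory.integral_const_mul]
        exact integral_congr_ae (ae_of_all _ fun θ => by simp only [hHX4]; rw [hΨ]; ring)
      -- integrability of the five slice integrands
      have j1 : IntegrableOn (fun θ => GD (R, θ) * Real.sin (2 * θ) ^ (-η)) (Ioo 0 (π / 2)) := intθu GD cGD R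
      have j2 : IntegrableOn (fun θ => (1 - 2 * η) * (GX1 (R, θ) * Real.sin (2 * θ) ^ (-η))) (Ioo 0 (π / 2)) := (intθu GX1 cGX1 R).const_mul _
      have j3 : IntegrableOn (fun θ => (1 / 2) * (1 + η) * (GX2 (R, θ) * Real.sin (2 * θ) ^ (-η))) (Ioo 0 (π / 2)) := (intθu GX2 cGX2 R).const_mul _
      have j4 : IntegrableOn (fun θ => GQ (R, θ) * Real.sin (2 * θ) ^ (-η)) (Ioo 0 (π / 2)) := intθu GQ cGQ R
      have j5 : IntegrableOn (fun θ => 2 * η * (1 + η) * (HX4 (R, θ) * Real.sin (2 * θ) ^ (-η))) (Ioo 0 (π / 2)) := by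
        obtain ⟨Kf, hKf0, hKf⟩ := exists_abs_le_mul_sin_two_mul (huθ R) (hD0 R) (hD1 R)
        have hm : Measurable fun θ => HX4 (R, θ) := by
          simp only [hHX4]
          have : Measurable fun θ => Ψ R θ := (cΨ.comp (Continuous.prodMk_right R)).measurable
          fun_prop
        refine (integrableOn_mul_sin_two_mul_rpow_of_abs_le hη0 hη1 hm (C := |W R| * Kf ^ 2) fun θ hθ => ?_).const_mul _
        simp only [hHX4]
        have hsθ : 0 < Real.sin (2 * θ) := Real.sin_pos_of_pos_of_lt_pi (by linarith [hθ.1]) (by linarith [hθ.2])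
        have h2 : |Real.cos (2 * θ) ^ 2| ≤ 1 := by
          rw [abs_of_nonneg (sq_nonneg _), ← sq_abs]; nlinarith [abs_nonneg (Real.cos (2 * θ)), Real.abs_cos_le_one (2 * θ)]
        have hq : |Ψ R θ / Real.sin (2 * θ)| ≤ Kf := by
          rw [abs_div, abs_of_pos hsθ, div_le_iff₀ hsθ]; exact hKf θ (Ioo_subset_Icc_self hθ)
        have h3 : |(Ψ R θ / Real.sin (2 * θ)) ^ 2| ≤ Kf ^ 2 := by
          rw [abs_of_nonneg (sq_nonneg _), ← sq_abs]; exact pow_le_pow_left₀ (abs_nonneg _) hq 2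
        calc _ ≤ |W R| * 1 * Kf ^ 2 := abs_mul₃_le le_rfl h2 h3 (abs_nonneg _) zero_le_one
          _ = _ := by ring
      have j12 : IntegrableOn (fun θ => GD (R, θ) * Real.sin (2 * θ) ^ (-η) - (1 - 2 * η) * (GX1 (R, θ) * Real.sin (2 * θ) ^ (-η))) (Ioo 0 (π / 2)) := j1.sub j2
      have j123 : IntegrableOn (fun θ => GD (R, θ) * Real.sin (2 * θ) ^ (-η) - (1 - 2 * η) * (GX1 (R, θ) * Real.sin (2 * θ) ^ (-η)) +
          (1 / 2) * (1 + η) * (GX2 (R, θ) * Real.sin (2 * θ) ^ (-η))) (Ioo 0 (π / 2)) := j12.add j3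
      have j1234 : IntegrableOn (fun θ => GD (R, θ) * Real.sin (2 * θ) ^ (-η) - (1 - 2 * η) * (GX1 (R, θ) * Real.sin (2 * θ) ^ (-η)) +
          (1 / 2) * (1 + η) * (GX2 (R, θ) * Real.sin (2 * θ) ^ (-η)) - GQ (R, θ) * Real.sin (2 * θ) ^ (-η)) (Ioo 0 (π / 2)) := j123.sub j4
      rw [integral_add j1234 j5, integral_sub j123 j4, integral_add j12 j3, integral_sub j1 j2, MeasureTheory.integral_const_mul,
        MeasureTheory.integral_const_mul, MeasureTheory.integral_const_mul, eD, eX1, eX2, eQ, eX4, hL4, hL3h, hL3k, hL6]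
      ring)
    have k1 : IntegrableOn (fun p => GD p * Real.sin (2 * p.2) ^ (-η) - (1 - 2 * η) * (GX1 p * Real.sin (2 * p.2) ^ (-η))) strip := iD.sub (iX1.const_mul _)
    have k2 : IntegrableOn (fun p => GD p * Real.sin (2 * p.2) ^ (-η) - (1 - 2 * η) * (GX1 p * Real.sin (2 * p.2) ^ (-η)) + (1 / 2) * (1 + η) * (GX2 p * Real.sin (2 * p.2) ^ (-η))) strip :=
      k1.add (iX2.const_mul _)
    have k3 : IntegrableOn (fun p => GD p * Real.sin (2 * p.2) ^ (-η) - (1 - 2 * η) * (GX1 p * Real.sin (2 * p.2) ^ (-η)) + (1 / 2) * (1 + η) * (GX2 p * Real.sin (2 * p.2) ^ (-η)) - GQ p * Real.sin (2 * p.2) ^ (-η)) strip :=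
      k2.sub iQ
    have k4 : IntegrableOn (fun p => 2 * η * (1 + η) * (HX4 p * Real.sin (2 * p.2) ^ (-η))) strip := iX4.const_mul _
    have k5 : IntegrableOn (fun p => (1 - 2 * η) * (GX1 p * Real.sin (2 * p.2) ^ (-η))) strip := iX1.const_mul _
    have k6 : IntegrableOn (fun p => (1 / 2) * (1 + η) * (GX2 p * Real.sin (2 * p.2) ^ (-η))) strip := iX2.const_mul _
    rw [integral_add k3 k4, integral_sub k2 iQ, integral_add k1 k6, integral_sub iD k5, MeasureTheory.integral_const_mul,
      MeasureTheory.integral_const_mul, MeasureTheory.integral_const_mul] at h0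
    linear_combination h0
  ----------------------------------------------------------------
  -- assemble
  ----------------------------------------------------------------
  rw [setIntegral_congr_fun measurableSet_strip hpt]
  have i1 : IntegrableOn (fun p => α ^ 2 * (GA p * Real.sin (2 * p.2) ^ (-η))) strip := iA.const_mul _
  have i2 : IntegrableOn (fun p => α * (5 + α) * (GB p * Real.sin (2 * p.2) ^ (-η))) strip := iB.const_mul _
  have i5 : IntegrableOn (fun p => 6 * (GE p * Real.sin (2 * p.2) ^ (-η))) strip := iE.const_mul _
  have k12 : IntegrableOn (fun p => α ^ 2 * (GA p * Real.sin (2 * p.2) ^ (-η)) + α * (5 + α) * (GB p * Real.sin (2 * p.2) ^ (-η))) strip := i1.add i2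
  have k123 : IntegrableOn (fun p => α ^ 2 * (GA p * Real.sin (2 * p.2) ^ (-η)) + α * (5 + α) * (GB p * Real.sin (2 * p.2) ^ (-η)) + GP p * Real.sin (2 * p.2) ^ (-η)) strip := k12.add iP
  have k1234 : IntegrableOn (fun p => α ^ 2 * (GA p * Real.sin (2 * p.2) ^ (-η)) + α * (5 + α) * (GB p * Real.sin (2 * p.2) ^ (-η)) + GP p * Real.sin (2 * p.2) ^ (-η) + GD p * Real.sin (2 * p.2) ^ (-η)) strip :=
    k123.add iD
  rw [integral_add k1234 i5, integral_add k123 iD, integral_add k12 iP, integral_add i1 i2,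
    MeasureTheory.integral_const_mul, MeasureTheory.integral_const_mul, MeasureTheory.integral_const_mul, hIAa, hIAb, hID]
  simp only [hGA1, hGZ, hGA3, hHA4, hGB, hGP, hGE, hGX1, hGX2, hGQ, hHX4, hM]
  have r1 : ∫ p in strip, deriv (fun R => R ^ 2 * W R) p.1 * (dz Ψ p.1 p.2 * dθ (dθ Ψ) p.1 p.2) * Real.sin (2 * p.2) ^ (-η) =
      ∫ p in strip, deriv (fun R => R ^ 2 * W R) p.1 * dz Ψ p.1 p.2 * dθ (dθ Ψ) p.1 p.2 * Real.sin (2 * p.2) ^ (-η) :=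
    integral_congr_ae (ae_of_all _ fun p => by ring)
  have r2 : ∫ p in strip, W p.1 * (p.1 * dz Ψ p.1 p.2 * dθ (dθ Ψ) p.1 p.2) * Real.sin (2 * p.2) ^ (-η) =
      ∫ p in strip, W p.1 * (p.1 * dz Ψ p.1 p.2) * dθ (dθ Ψ) p.1 p.2 * Real.sin (2 * p.2) ^ (-η) :=
    integral_congr_ae (ae_of_all _ fun p => by ring)
  have r3 : ∫ p in strip, W p.1 * (Ψ p.1 p.2 * dθ (dθ Ψ) p.1 p.2) * Real.sin (2 * p.2) ^ (-η) =
      ∫ p in strip, W p.1 * Ψ p.1 p.2 * dθ (dθ Ψ) p.1 p.2 * Real.sin (2 * p.2) ^ (-η) :=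
    integral_congr_ae (ae_of_all _ fun p => by ring)
  have r4 : ∫ p in strip, W p.1 * (Real.cos (2 * p.2) * χ p.1 p.2 ^ 2) * Real.sin (2 * p.2) ^ (-η) =
      ∫ p in strip, W p.1 * Real.cos (2 * p.2) * χ p.1 p.2 ^ 2 * Real.sin (2 * p.2) ^ (-η) :=
    integral_congr_ae (ae_of_all _ fun p => by ring)
  have r5 : ∫ p in strip, W p.1 * ((Real.cos p.2 ^ 2 + 2 * Real.sin p.2 ^ 2 + (1 / 2) * (1 - η) * Real.cos (2 * p.2)) *
      dθ χ p.1 p.2 ^ 2) * Real.sin (2 * p.2) ^ (-η) =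
      ∫ p in strip, W p.1 * (Real.cos p.2 ^ 2 + 2 * Real.sin p.2 ^ 2 + (1 / 2) * (1 - η) * Real.cos (2 * p.2)) *
        dθ χ p.1 p.2 ^ 2 * Real.sin (2 * p.2) ^ (-η) :=
    integral_congr_ae (ae_of_all _ fun p => by ring)
  rw [r1, r2, r3, r4, r5]
  ring

end Elgindi

end Literature.Analysis.FluidPDE
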